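import Mathlib
import Summits.CriticalPhenomena.CardyFormulaZ2.Theorems.CardySelfRefinementGradientComparabilityStubBulkPivotalSumDivergesRoutes
import Summits.CriticalPhenomena.CardyFormulaZ2.Theorems.CardySelfRefinementGradientComparabilityStubBulkPivotalSumDivergesTube
import Summits.CriticalPhenomena.CardyFormulaZ2.Theorems.CardySelfRefinementGradientComparabilityStubBulkPivotalSumDivergesDecoupling
import Summits.CriticalPhenomena.CardyFormulaZ2.Theorems.CardySelfRefinementGradientComparabilityStubBulkPivotalSumDivergesSmall
import HarnessLib

/-!
# Non-degeneracy of the joint crossing event of a quad family GIVEN THE BOUNDARY LAYER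

Crux `stmt-CriticalPhenomena-10269`
(`Summit.CriticalPhenomena.CardyFormulaZ2.Theses.CardySelfRefinement.GradientComparability`),
line **Sketch**, helper file of the stub `stub_bulkPivotalSum_diverges` (D3-bulk): hypothesis
`hC` of `bulkPivotalSum_diverges_of_condVariance`.  Vocabulary (`Aloc`, `window`, `nnSupport`)
from `CardySelfRefinementDefs` / `…RussoDriftModel`.

## Mathematics

**Theorem (`condVariance_given_layer`, registered sub-goal).**  For a nonempty finite quad family
`F` there are `v₀, r_C, η_C > 0` such that for every mesh `η < η_C`, with `W` the window, and every
`L ⊆ W` all of whose edges have an endpoint at drawn distance `< r_C` from `∂F = ⋃ᵢ ∂(F i)`: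
`v₀ ≤ Σ_{ξ ⊆ L} P(ω ∩ L = ξ) t_ξ(1 − t_ξ)`, `t_ξ = P((ζ ∖ L) ∪ ξ ∈ Aloc)`.

*Proof.*  By `exists_routes` there are a leaf `κ` of the chart of the transposed first quad,
routed chart paths `γ_i` for the `F i`, and `w > 0` with no point within `w` of `H_i∘γ_i`, `κ` and
`∂F` simultaneously.  Thin tubes (`tube_of_chart_path`, width `≤ w/100`) give the events
(`eventually_tube_of_data`): `O` = all open tubes crossed (so every `F i` is crossed, `O ⊆ Aloc`
on lattice configurations), `K` = the dual tube along `κ` crossed by closed edges (so `F 0` is not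
crossed, planar duality as in (D1)); `P(O) ≥ ∏ cᵢ`, `P(K) ≥ c'` (RSW, Harris, self-duality).
`O` is read off edges drawn within `6sᵢ` of the arcs, `K` off edges within `6s' + O(η)` of `κ`; an
edge of the layer `L` (within `r_C = w/4` of `∂F`) read by both would produce a point within `w`
of all three sets.  So the supports share no layer edge and `condVariance_ge_of_disjoint_supports`
gives `v₀ = (∏ cᵢ) c' ≤ P(O) P(K) ≤ Σ_ξ P(ω ∩ L = ξ) t_ξ(1 − t_ξ)`.
-/

noncomputable section

namespace Summit.CriticalPhenomena.CardyFormulaZ2.Theorems.CardySelfRefinement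

open scoped Topology
open Filter Set MeasureTheory Metric
open Literature.Probability.LatticeModels Literature.Probability.Percolation
open Literature.Probability.Percolation.QuadCrossing
open Summit.CriticalPhenomena.CardyFormulaZ2.Theses.CardySelfRefinement

/-- A lattice edge and its dual edge share an endpoint. -/
theorem exists_mem_mem_dualEdge {e : Sym2 (Site 2)} (he : e ∈ (zdGraph 2).edgeSet) :
    ∃ u ∈ e, u ∈ dualEdge e := by
  induction e using Sym2.ind with
  | h x y =>
    rw [SimpleGraph.mem_edgeSet, zdGraph_adj_iff] at he
    obtain ⟨i, h | h⟩ := he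
    · subst h
      refine ⟨x, Sym2.mem_mk_left _ _, ?_⟩
      have hi : i = 0 ∨ i = 1 := by fin_cases i <;> simp
      rcases hi with rfl | rfl
      · rw [dualEdge_horizontal]; exact Sym2.mem_mk_right _ _
      · rw [dualEdge_vertical]; exact Sym2.mem_mk_right _ _
    · subst h
      refine ⟨y, Sym2.mem_mk_right _ _, ?_⟩
      rw [Sym2.eq_swap]
      have hi : i = 0 ∨ i = 1 := by fin_cases i <;> simp
      rcases hi with rfl | rfl
      · rw [dualEdge_horizontal]; exact Sym2.mem_mk_right _ _
      · rw [dualEdge_vertical]; exact Sym2.mem_mk_right _ _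

/-- Every endpoint of a lattice edge is within one drawn lattice step of an endpoint of its dual
edge. -/
theorem exists_mem_dualEdge_dist_le {e : Sym2 (Site 2)} (he : e ∈ (zdGraph 2).edgeSet)
    {y : Site 2} (hy : y ∈ e) (η : ℝ) :
    ∃ u ∈ dualEdge e, dist ((η : ℂ) * squareLatticeEmbedding.z y)
      ((η : ℂ) * squareLatticeEmbedding.z u) ≤ 2 * Real.sqrt 2 * |η| := by
  obtain ⟨u, hue, hud⟩ := exists_mem_mem_dualEdge he
  refine ⟨u, hud, ?_⟩
  by_cases hyu : y = u
  · subst hyu; rw [dist_self]; positivity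
  · refine dist_z_le_of_adj ?_ η
    induction e using Sym2.ind with
    | h p q =>
      have hpq : (zdGraph 2).Adj p q := (SimpleGraph.mem_edgeSet _).1 he
      rcases Sym2.mem_iff.1 hy with rfl | rfl <;> rcases Sym2.mem_iff.1 hue with rfl | rfl
      · exact absurd rfl hyu
      · exact hpq
      · exact hpq.symm
      · exact absurd rfl hyu

/-- **Non-degeneracy of the joint crossing event given the boundary layer.** -/
theorem condVariance_given_layer :
    ∀ (m : ℕ) (F : Fin m → Quad (Set.univ : Set ℂ)), 0 < m → ∃ v₀ rC ηC : ℝ, 0 < v₀ ∧ 0 < rC ∧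
      0 < ηC ∧ ∀ η ∈ Set.Ioo 0 ηC, ∀ W L : Finset (Sym2 (Site 2)),
        (↑W : Set (Sym2 (Site 2))) = window m F η → L ⊆ W →
        (∀ f ∈ L, ∃ y ∈ f, ∃ (i : Fin m) (j : Fin 4), ∃ p ∈ (F i).side j,
          dist ((η : ℂ) * squareLatticeEmbedding.z y) p < rC) →
        v₀ ≤ ∑ ξ ∈ L.powerset, (bondPercolation (zdGraph 2) half).real {ω | obs ω L = ξ} *
          ((bondPercolation (zdGraph 2) half).real
              {ω' : BondConfig (Site 2) | ω' \ ↑L ∪ ↑ξ ∈ Aloc m F η} *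
            (1 - (bondPercolation (zdGraph 2) half).real
              {ω' : BondConfig (Site 2) | ω' \ ↑L ∪ ↑ξ ∈ Aloc m F η})) := by
  intro m F hm
  obtain ⟨w, hw, Qt, Ht, a, htcar, ht0, ht2, htcar', ht0', ht2', ha, Hc, γ, hHc, hγ, hdisj⟩ :=
    exists_routes m F hm
  -- the leaf path of the closed skeleton
  set γt : ℝ → ℂ := fun u => ((-2 + 4 * u : ℝ) : ℂ) + (a : ℂ) * Complex.I with hγt
  have hγtc : ContinuousOn γt (Icc 0 1) := by
    refine Continuous.continuousOn ?_
    simp only [hγt]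
    fun_prop
  have hγtre : ∀ u : ℝ, (γt u).re = -2 + 4 * u := fun u => by simp [hγt]
  have hγtim : ∀ u : ℝ, (γt u).im = a := fun u => by simp [hγt]
  have hγtm : MapsTo γt (Icc 0 1) (Icc (-2 : ℝ) 2 ×ℂ Icc (-1 / 2 : ℝ) (1 / 2)) := by
    intro u hu
    rw [Complex.mem_reProdIm, hγtre, hγtim]
    exact ⟨⟨by linarith [hu.1], by linarith [hu.2]⟩, ⟨by linarith [ha.1], by linarith [ha.2]⟩⟩
  have hγt0 : (γt 0).re = -2 := by rw [hγtre]; norm_num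
  have hγt1 : (γt 1).re = 2 := by rw [hγtre]; norm_num
  have hγtκ : ∀ u ∈ Icc (0 : ℝ) 1, Ht (γt u) ∈ Ht '' (Icc (-2 : ℝ) 2 ×ℂ {(a : ℝ)}) := fun u hu =>
    mem_image_of_mem _ (by
      rw [Complex.mem_reProdIm, hγtre, hγtim]
      exact ⟨⟨by linarith [hu.1], by linarith [hu.2]⟩, rfl⟩)
  obtain ⟨N', P', s', hs', hs'w, hP'on, hP'd, htube'⟩ := tube_of_chart_path Qt Ht htcar' ht0' ht2'
    hγtc hγtm hγt0 hγt1 (smax := w / 100) (by positivity)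
  -- the routed open tubes
  have hO_data : ∀ i, ∃ (N : ℕ) (P : ℕ → ℂ) (s : ℝ), 0 < s ∧ s ≤ w / 100 ∧
      (∀ j ≤ N, ∃ u ∈ Icc (0 : ℝ) 1, P j = Hc i (γ i u)) ∧
      (∀ j < N, dist (P j) (P (j + 1)) ≤ s) ∧
      ∀ (GOOD C : Set ℂ), IsCompact C → IsPreconnected C → C ⊆ GOOD →
        (∀ z ∈ C, ∃ j ≤ N, dist z (P j) ≤ 10 * s) → (∃ z ∈ C, dist z (P 0) ≤ 10 * s) →
        (∃ z ∈ C, dist z (P N) ≤ 10 * s) → ∃ K, (F i).IsCrossing K ∧ K ⊆ GOOD := fun i =>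
    tube_of_chart_path (F i) (Hc i) (hHc i).1 (hHc i).2.1 (hHc i).2.2 (hγ i).1 (hγ i).2.1
      (hγ i).2.2.1 (hγ i).2.2.2 (by positivity)
  choose N P s hs hsw hPon hPd htube using hO_data
  choose T c hc hTev using fun i => eventually_tube_of_data (F i) (hs i) (hPd i) (htube i)
  obtain ⟨T', c', hc', hT'ev⟩ := eventually_tube_of_data Qt hs' hP'd htube'
  have hall := (eventually_all.2 hTev).and hT'ev
  rw [eventually_nhdsWithin_iff, Metric.eventually_nhds_iff] at hall
  obtain ⟨ε, hε, hεall⟩ := hall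
  refine ⟨(∏ i, c i) * c', w / 4, min ε (w / 100), mul_pos (Finset.prod_pos fun i _ => hc i) hc',
    by positivity, by positivity, ?_⟩
  intro η hη W L hW hL hlayer
  have hη0 : 0 < η := hη.1
  have hηε : η < ε := lt_of_lt_of_le hη.2 (min_le_left _ _)
  have hηw : η < w / 100 := lt_of_lt_of_le hη.2 (min_le_right _ _)
  obtain ⟨hprim, hT'm, -, hT'c, hT'det, hK'⟩ :=
    hεall (by rw [Real.dist_eq, sub_zero, abs_of_pos hη0]; exact hηε : dist η 0 < ε) hη0
  set μ := bondPercolation (zdGraph 2) half with hμ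
  have hδ : 0 < η * Real.sqrt 2 := by positivity
  -- the two skeleton events
  set O : Set (BondConfig (Site 2)) := ⋂ i ∈ (Finset.univ : Finset (Fin m)), T i η with hOdef
  set K : Set (BondConfig (Site 2)) := dualConfig ⁻¹' T' η with hKdef
  have hOm : MeasurableSet O := Finset.univ.measurableSet_biInter fun i _ => (hprim i).1
  have hKm : MeasurableSet K := measurable_dualConfig hT'm
  -- their supports
  set Sv : Set (Site 2) := {x | ∃ i : Fin m, ∃ j ≤ N i,
    dist ((η : ℂ) * squareLatticeEmbedding.z x) (P i j) ≤ 6 * s i} with hSv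
  have hSvf : Sv.Finite := by
    have hsub : Sv ⊆ ⋃ i : Fin m, ⋃ j ∈ Finset.range (N i + 1),
        {x | dist (meshPoint (η * Real.sqrt 2) x) (P i j) ≤ 6 * s i} := by
      rintro x ⟨i, j, hj, hd⟩
      refine mem_iUnion.2 ⟨i, mem_iUnion₂.2 ⟨j, Finset.mem_range.2 (Nat.lt_succ_of_le hj), ?_⟩⟩
      rwa [mem_setOf_eq, ← eta_mul_z_eq_meshPoint]
    exact (finite_iUnion fun i => (Finset.range (N i + 1)).finite_toSet.biUnion fun j _ =>
      finite_setOf_dist_meshPoint_le hδ _ _).subset hsub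
  set SO : Finset (Sym2 (Site 2)) := hSvf.toFinset.sym2 with hSO
  have hOdet : DeterminedBy O (↑SO : Set (Sym2 (Site 2))) := by
    refine determinedBy_biInter_finset _ fun i _ => ((hprim i).2.2.2.1).mono fun e he => ?_
    rw [Finset.mem_coe, Finset.mem_sym2_iff]
    intro x hx
    rw [hSvf.mem_toFinset]
    obtain ⟨j, hj, hd⟩ := he x hx
    exact ⟨i, j, hj, hd⟩
  set Sv' : Set (Site 2) := {x | ∃ j ≤ N',
    dist ((η : ℂ) * squareLatticeEmbedding.z x) (P' j) ≤ 6 * s'} with hSv'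
  have hSv'f : Sv'.Finite := by
    have hsub : Sv' ⊆ ⋃ j ∈ Finset.range (N' + 1),
        {x | dist (meshPoint (η * Real.sqrt 2) x) (P' j) ≤ 6 * s'} := by
      rintro x ⟨j, hj, hd⟩
      refine mem_iUnion₂.2 ⟨j, Finset.mem_range.2 (Nat.lt_succ_of_le hj), ?_⟩
      rwa [mem_setOf_eq, ← eta_mul_z_eq_meshPoint]
    exact ((Finset.range (N' + 1)).finite_toSet.biUnion fun j _ =>
      finite_setOf_dist_meshPoint_le hδ _ _).subset hsub
  set D' : Finset (Sym2 (Site 2)) := hSv'f.toFinset.sym2 with hD'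
  have hT'det' : DeterminedBy (T' η) (↑D' : Set (Sym2 (Site 2))) := by
    refine hT'det.mono fun e he => ?_
    rw [Finset.mem_coe, Finset.mem_sym2_iff]
    intro x hx
    rw [hSv'f.mem_toFinset]
    exact he x hx
  set SK : Finset (Sym2 (Site 2)) := D'.preimage dualEdge dualEdge_bijective.injective.injOn
    with hSK
  have hKdet : DeterminedBy K (↑SK : Set (Sym2 (Site 2))) := by
    rw [hSK, Finset.coe_preimage]
    exact hT'det'.preimage_dualConfig
  -- no layer edge is read by both skeletons
  have h22 : Real.sqrt 2 < 3 / 2 := by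
    rw [Real.sqrt_lt' (by norm_num)]; norm_num
  have hdisjL : ∀ e ∈ SO, e ∈ SK → e ∉ L := by
    intro e heO heK heL
    obtain ⟨y, hy, i, j, p, hp, hdp⟩ := hlayer e heL
    have hyO := (Finset.mem_sym2_iff.1 heO) y hy
    rw [hSvf.mem_toFinset] at hyO
    obtain ⟨i₀, j₀, hj₀, hd₀⟩ := hyO
    obtain ⟨u, hu, hPu⟩ := hPon i₀ j₀ hj₀
    rw [hSK, Finset.mem_preimage] at heK
    have heW : e ∈ window m F η := by rw [← hW]; exact Finset.mem_coe.2 (hL heL)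
    have heE : e ∈ (zdGraph 2).edgeSet := mem_edgeSet_of_mem_window heW
    obtain ⟨u', hu'd, hdu'⟩ := exists_mem_dualEdge_dist_le heE hy η
    have hu'D := (Finset.mem_sym2_iff.1 heK) u' hu'd
    rw [hSv'f.mem_toFinset] at hu'D
    obtain ⟨j₁, hj₁, hd₁⟩ := hu'D
    obtain ⟨u₁, hu₁, hP'u₁⟩ := hP'on j₁ hj₁
    refine hdisj i₀ ((η : ℂ) * squareLatticeEmbedding.z y) u hu (P' j₁) (hP'u₁ ▸ hγtκ u₁ hu₁) p
      (mem_iUnion.2 ⟨i, mem_iUnion.2 ⟨j, hp⟩⟩) ?_ ?_ ?_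
    · rw [← hPu]
      have := hsw i₀
      linarith
    · rw [abs_of_pos hη0] at hdu'
      calc dist ((η : ℂ) * squareLatticeEmbedding.z y) (P' j₁)
          ≤ dist ((η : ℂ) * squareLatticeEmbedding.z y) ((η : ℂ) * squareLatticeEmbedding.z u') +
            dist ((η : ℂ) * squareLatticeEmbedding.z u') (P' j₁) := dist_triangle _ _ _
        _ < w := by nlinarith
    · linarith
  -- the crossing criterion on lattice configurations
  have hcrit : ∀ ω ∈ nnSupport, ∀ Q : Quad (univ : Set ℂ),
      Q ∈ configOf squareLatticeEmbedding.z η univ ω ↔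
        ∃ K, Q.IsCrossing K ∧ K ⊆ openEdgeUnion (η * Real.sqrt 2) ω := by
    intro ω hω Q
    have e : configOf squareLatticeEmbedding.z η univ ω =
        z2QuadConfig univ (η * Real.sqrt 2) ω := by
      rw [configOf_squareLatticeEmbedding]
      simp only [z2QuadConfig, inter_eq_left.mpr (show ω ⊆ (zdGraph 2).edgeSet from hω)]
    rw [show (Q ∈ configOf squareLatticeEmbedding.z η univ ω ↔
        Q ∈ z2QuadConfig univ (η * Real.sqrt 2) ω) from by rw [e]]
    exact mem_z2QuadConfig_iff_exists_isCrossing hδ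
  -- `O ⊆ Aloc` on lattice configurations
  have hOA : O ∩ nnSupport ⊆ Aloc m F η := by
    rintro ω ⟨hω, hωN⟩
    have hA : ω ∈ A m F η := fun i => by
      obtain ⟨Kc, hKQ, hKO⟩ := (hprim i).2.2.2.2 0 (by simp; positivity) (by simp; positivity) ω
        (mem_iInter₂.1 hω i (Finset.mem_univ _)) hωN
      exact (hcrit ω hωN (F i)).2 ⟨Kc, hKQ, fun z hz => by simpa using hKO z hz⟩
    have h' : ω ∈ A m F η ∩ nnSupport := ⟨hA, hωN⟩
    rw [A_inter_nnSupport_eq] at h'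
    exact h'.1
  -- `K ⊆ Alocᶜ` on lattice configurations (planar duality, as in (D1))
  have hsq2 : Real.sqrt 2 ≤ 2 := by
    nlinarith [Real.sq_sqrt (show (0 : ℝ) ≤ 2 by norm_num), Real.sqrt_nonneg 2]
  have hsh : |(SSContinuity.dualShift (η * Real.sqrt 2)).re| ≤ 2 * η ∧
      |(SSContinuity.dualShift (η * Real.sqrt 2)).im| ≤ 2 * η := by
    have hn := SSContinuity.norm_dualShift_le hδ.le
    exact ⟨(Complex.abs_re_le_norm _).trans (hn.trans (by nlinarith)),
      (Complex.abs_im_le_norm _).trans (hn.trans (by nlinarith))⟩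
  have hKA : ∀ ω ∈ K, ω ∈ nnSupport → ω ∉ Aloc m F η := by
    intro ω hωD hωN hωAloc
    have hωA : ω ∈ A m F η := by
      have h' : ω ∈ Aloc m F η ∩ nnSupport := ⟨hωAloc, hωN⟩
      rw [← A_inter_nnSupport_eq] at h'
      exact h'.1
    have hsub' : dualConfig ω ⊆ (zdGraph 2).edgeSet := fun e he => (mem_dualConfig_iff.1 he).1
    obtain ⟨Kd, ⟨hKc, hKconn, hKQ, hK1, hK3⟩, hKO⟩ := hK' _ hsh.1 hsh.2 (dualConfig ω) hωD hsub'
    obtain ⟨K₀, ⟨hK₀c, hK₀conn, hK₀Q, ⟨a₀, haK, ha₀⟩, ⟨b₀, hbK, hb₀⟩⟩, hK₀O⟩ :=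
      (hcrit ω hωN (F ⟨0, hm⟩)).1 (hωA ⟨0, hm⟩)
    obtain ⟨π, hπ⟩ := joinedIn_inter_openEdgeUnion_of_isConnected hδ hK₀c hK₀conn hK₀O hK₀Q
      haK hbK
    have hπ' : ∀ u, π.extend u ∈ (F ⟨0, hm⟩).carrier ∩ openEdgeUnion (η * Real.sqrt 2) ω :=
      fun u => by
        obtain ⟨v, hv⟩ : π.extend u ∈ range π := by rw [← π.extend_range]; exact mem_range_self u
        rw [← hv]; exact hπ v
    obtain ⟨u, -, hu⟩ := (F ⟨0, hm⟩).exists_mem_of_isPreconnected_crossing' hKc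
      hKconn.isPreconnected (htcar ▸ hKQ) (ht0 ▸ hK1) (ht2 ▸ hK3) (β := fun u => π.extend u)
      π.continuous_extend.continuousOn (fun u _ => (hπ' u).1) (by simpa using ha₀)
      (by simpa using hb₀)
    exact SSContinuity.not_mem_openEdgeUnion_dualConfig_sub hδ (hπ' u).2 (hKO _ hu)
  -- probabilities of the skeletons
  have hO : ∏ i, c i ≤ μ.real O :=
    calc ∏ i, c i ≤ ∏ i, μ.real (T i η) :=
          Finset.prod_le_prod (fun i _ => (hc i).le) fun i _ => (hprim i).2.2.1
      _ ≤ μ.real O := real_biInter_ge_prod (zdGraph 2) half _ _ (fun i _ => (hprim i).2.1)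
          fun i _ => (hprim i).1
  have hK : c' ≤ μ.real K := by
    have hDμ : μ.real K = μ.real (T' η) := by
      rw [measureReal_def, measureReal_def, hKdef, ← Measure.map_apply measurable_dualConfig hT'm,
        bondPercolation_map_dualConfig_holds half,
        show unitInterval.symm half = half from Subtype.ext (by simp [half]; norm_num)]
    rw [hDμ]
    exact hT'c
  have hdec := condVariance_ge_of_disjoint_supports m F hη0.ne' hW hOm hKm hOdet hKdet hdisjL
    hOA hKA
  calc (∏ i, c i) * c' ≤ μ.real O * μ.real K := mul_le_mul hO hK hc'.le measureReal_nonneg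
    _ ≤ _ := hdec

end Summit.CriticalPhenomena.CardyFormulaZ2.Theorems.CardySelfRefinement

end
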